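import Summits.KontsevichZagierPeriods.KontsevichZagierPeriods.Theorems.PlanarAreas.Negative.WindowInvariant
import Literature.NumberTheory.Transcendental.KZCalculusProofs

/-!
# `PlanarAreas` (stmt-KontsevichZagierPeriods-4990): negative side — V. the `1 → 0` defect and the closure induction

A Newton–Leibniz move from dimension `1` to dimension `0` changes the window value
`e ↦ Λₑ` by a CLAMPED PRIMITIVE `F(max a₀ (min e b₀)) − F(a₀)`, a `ℚ`-semialgebraic function of `e`
plus a constant (`nl_zero_defect`).  Hence along every chain of rules 1a/1b/3 (all dimensions) the
window values are semialgebraic in `e` up to an additive constant (`winSemialgebraic_of_mem`,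
closure induction). -/

noncomputable section

open Set MeasureTheory MvPolynomial Filter Topology
open Literature.NumberTheory.Transcendental Literature.ModelTheory.ExponentialFields

namespace Summit.KontsevichZagierPeriods.PlanarAreas.Negative

open Summit.KontsevichZagierPeriods.KontsevichZagierPeriods.Theses.SymplecticScissors
  (PlanarAreas VolumeForm PlanarK0Injective GroupToAreas)

/-- **The `1 → 0` defect.** For a Newton–Leibniz move from dimension `1` to dimension `0`, the
window value `e ↦ Λₑ([r] − [r'])` is a `ℚ`-semialgebraic function of `e` plus a constant
(the clamped primitive `F(max a₀ (min e b₀)) − F(a₀)`; zero if the base is empty). -/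
theorem nl_zero_defect (r : KZ.IntegralRep (0 + 1)) (r' : KZ.IntegralRep 0)
    (a b : (Fin 0 → ℝ) → ℝ) (F : (Fin (0 + 1) → ℝ) → ℝ)
    (hF : IsSemialgebraicFunOn ℚ r.domain F)
    (ha : IsSemialgebraicFunOn ℚ r'.domain a) (hb : IsSemialgebraicFunOn ℚ r'.domain b)
    (hab : ∀ x ∈ r'.domain, a x ≤ b x)
    (hdom : r.domain = {z | (Fin.init z : Fin 0 → ℝ) ∈ r'.domain ∧
      a (Fin.init z) ≤ z (Fin.last 0) ∧ z (Fin.last 0) ≤ b (Fin.init z)})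
    (hcont : ∀ x ∈ r'.domain, ContinuousOn (fun t : ℝ => F (Fin.snoc x t)) (Icc (a x) (b x)))
    (hderiv : ∀ x ∈ r'.domain, ∀ t ∈ Ioo (a x) (b x),
      HasDerivAt (fun s : ℝ => F (Fin.snoc x s)) (r.integrand (Fin.snoc x t)) t) :
    ∃ (Φ : ℝ → ℝ) (C : ℝ), IsSemialgebraicFunOn ℚ (univ : Set (Fin 1 → ℝ)) (fun z => Φ (z 0)) ∧
      ∀ e, KZ.restrictedEval (win e) (KZ.of r - KZ.of r') = Φ e + C := by
  have hzero : ∀ e, KZ.restrictedEval (win e) (KZ.of r') = 0 := fun e => by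
    rw [KZ.restrictedEval_of, win_zero, inter_empty, Measure.restrict_empty, integral_zero_measure]
  by_cases hτ : r'.domain = ∅
  · -- empty base: empty band, zero defect
    have hr : r.domain = ∅ := by
      rw [hdom]; ext z; simp [hτ]
    refine ⟨fun _ => 0, 0, by simpa using isSemialgebraicFunOn_natCast isSemialgebraic_univ 0, ?_⟩
    intro e
    rw [map_sub, hzero, KZ.restrictedEval_of, hr, empty_inter, Measure.restrict_empty,
      integral_zero_measure]
    simp
  · obtain ⟨x₀, hx₀⟩ := nonempty_iff_ne_empty.mpr hτ
    have hall : ∀ x : Fin 0 → ℝ, x = x₀ := fun x => Subsingleton.elim _ _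
    set a₀ := a x₀ with ha₀
    set b₀ := b x₀ with hb₀
    have hab₀ : a₀ ≤ b₀ := hab x₀ hx₀
    have hsnoc : ∀ t : ℝ, (Fin.snoc x₀ t : Fin (0 + 1) → ℝ) = fun _ => t := by
      intro t
      funext i
      have hi : i = Fin.last 0 := Fin.ext (by have := i.isLt; simp only [Fin.val_last]; omega)
      rw [hi]
      exact Fin.snoc_last _ _
    have hdom' : r.domain = {z : Fin (0 + 1) → ℝ | a₀ ≤ z 0 ∧ z 0 ≤ b₀} := by
      rw [hdom]
      ext z
      simp only [mem_setOf_eq]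
      have h1 : (Fin.init z : Fin 0 → ℝ) = x₀ := hall _
      have h2 : (Fin.last 0 : Fin (0 + 1)) = 0 := rfl
      rw [h1, h2]
      exact ⟨fun h => ⟨h.2.1, h.2.2⟩, fun h => ⟨hx₀, h.1, h.2⟩⟩
    -- the defect as a clamped primitive
    let f : ℝ → ℝ := fun t => F (fun _ => t)
    let g : ℝ → ℝ := fun t => r.integrand (fun _ => t)
    have hcont₀ : ContinuousOn f (Icc a₀ b₀) := by
      have := hcont x₀ hx₀
      simp_rw [hsnoc] at this
      exact this
    have hderiv₀ : ∀ t ∈ Ioo a₀ b₀, HasDerivAt f (g t) t := by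
      intro t ht
      have := hderiv x₀ hx₀ t ht
      simp_rw [hsnoc] at this
      exact this
    -- transfer integrals along `ℝ ≃ ℝ¹`
    set φ : ℝ → (Fin 1 → ℝ) := fun t _ => t with hφ_def
    have hφeq : φ = ⇑(MeasurableEquiv.funUnique (Fin 1) ℝ).symm := by
      funext t i
      show t = uniqueElim (α := fun _ : Fin 1 => ℝ) t i
      exact (uniqueElim_const t i).symm
    have hφ : MeasurePreserving φ volume volume := by
      rw [hφeq]
      exact (volume_preserving_funUnique (Fin 1) ℝ).symm _
    have hφemb : MeasurableEmbedding φ := by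
      rw [hφeq]
      exact (MeasurableEquiv.funUnique (Fin 1) ℝ).symm.measurableEmbedding
    have hint₀ : IntegrableOn g (Icc a₀ b₀) := by
      have h := (hφ.integrableOn_comp_preimage hφemb (f := r.integrand) (s := r.domain)).mpr
        r.integrableOn
      have hpre : φ ⁻¹' r.domain = Icc a₀ b₀ := by
        rw [hdom']; ext t; simp [hφ_def]
      rw [hpre] at h
      exact h
    have hval : ∀ e, KZ.restrictedEval (win e) (KZ.of r) = f (max a₀ (min e b₀)) - f a₀ := by
      intro e
      have hpre : φ ⁻¹' (r.domain ∩ win e (0 + 1)) = {t | a₀ ≤ t ∧ t ≤ b₀ ∧ t < e} := by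
        rw [hdom']
        ext t
        simp [hφ_def, and_assoc]
      have h1 : ∫ z in r.domain ∩ win e (0 + 1), r.integrand z =
          ∫ t in {t | a₀ ≤ t ∧ t ≤ b₀ ∧ t < e}, g t := by
        rw [← hφ.setIntegral_preimage_emb hφemb, hpre]
      rw [KZ.restrictedEval_of, h1, setIntegral_clamp hab₀ hcont₀ hderiv₀ hint₀ e]
    -- semialgebraicity of `e ↦ F(clamp e)`
    have hDa : IsSemialgebraic ℚ {y : Fin 1 → ℝ | y 0 = a₀} :=
      isSemialgebraic_setOf_apply_eq_of_fin_zero ha hx₀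
    have hDb : IsSemialgebraic ℚ {y : Fin 1 → ℝ | y 0 = b₀} :=
      isSemialgebraic_setOf_apply_eq_of_fin_zero hb hx₀
    have hclamp := isSemialgebraicFunOn_clamp hab₀ hDa hDb
    have hm : IsSemialgebraicMapOn ℚ (univ : Set (Fin 1 → ℝ))
        (fun z : Fin 1 → ℝ => fun _ : Fin 1 => max a₀ (min (z 0) b₀)) :=
      IsSemialgebraicMapOn.of_forall isSemialgebraic_univ fun _ => hclamp
    have hmaps : MapsTo (fun z : Fin 1 → ℝ => fun _ : Fin 1 => max a₀ (min (z 0) b₀)) univ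
        r.domain := by
      intro z _
      rw [hdom']
      exact ⟨le_max_left _ _, max_le hab₀ (min_le_right _ _)⟩
    have hcomp := IsSemialgebraicFunOn.comp_isSemialgebraicMapOn_holds hF hm hmaps
    refine ⟨fun e => f (max a₀ (min e b₀)), -f a₀, ?_, ?_⟩
    · exact hcomp
    · intro e
      rw [map_sub, hzero, hval, sub_zero, sub_eq_add_neg]

/-! ### Chains of rules 1a/1b/3 have semialgebraic window values -/

/-- `e ↦ Λₑ(c)` is a `ℚ`-semialgebraic function of `e` plus a constant. -/
def WinSemialgebraic (c : KZ.FormalRep) : Prop :=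
  ∃ (Φ : ℝ → ℝ) (C : ℝ), IsSemialgebraicFunOn ℚ (univ : Set (Fin 1 → ℝ)) (fun z => Φ (z 0)) ∧
    ∀ e, KZ.restrictedEval (win e) c = Φ e + C

/-- Vanishing window values are semialgebraic (the zero function). -/
theorem winSemialgebraic_of_eq_zero {c : KZ.FormalRep} (h : ∀ e, KZ.restrictedEval (win e) c = 0) :
    WinSemialgebraic c :=
  ⟨fun _ => 0, 0, by simpa using isSemialgebraicFunOn_natCast isSemialgebraic_univ 0,
    fun e => by simp [h e]⟩

/-- `0` has semialgebraic window values. -/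
theorem winSemialgebraic_zero : WinSemialgebraic 0 :=
  winSemialgebraic_of_eq_zero fun e => by simp

/-- Semialgebraic window values are stable under sums (Tarski–Seidenberg for the sum of two semialgebraic functions). -/
theorem WinSemialgebraic.add {c c' : KZ.FormalRep} (h : WinSemialgebraic c)
    (h' : WinSemialgebraic c') : WinSemialgebraic (c + c') := by
  obtain ⟨Φ, C, hΦ, hc⟩ := h
  obtain ⟨Φ', C', hΦ', hc'⟩ := h'
  refine ⟨fun e => Φ e + Φ' e, C + C', IsSemialgebraicFunOn.add_holds hΦ hΦ', fun e => ?_⟩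
  rw [map_add, hc, hc']
  ring

/-- Semialgebraic window values are stable under negation. -/
theorem WinSemialgebraic.neg {c : KZ.FormalRep} (h : WinSemialgebraic c) : WinSemialgebraic (-c) := by
  obtain ⟨Φ, C, hΦ, hc⟩ := h
  refine ⟨fun e => -Φ e, -C, hΦ.neg, fun e => ?_⟩
  rw [map_neg, hc]
  ring

/-- **The window invariant along the change-of-variables-free sub-calculus**: every element of
`closure (1a ∪ 1b ∪ 3)` has window values semialgebraic in `e` up to a constant. -/
theorem winSemialgebraic_of_mem {c : KZ.FormalRep}
    (hc : c ∈ AddSubgroup.closure (KZ.domainAddRel ∪ KZ.integrandAddRel ∪ KZ.newtonLeibnizRel)) :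
    WinSemialgebraic c := by
  refine AddSubgroup.closure_induction (p := fun x _ => WinSemialgebraic x) (fun x hx => ?_)
    winSemialgebraic_zero (fun x y _ _ hx hy => hx.add hy) (fun x _ hx => hx.neg) hc
  rcases hx with (hx | hx) | hx
  · exact winSemialgebraic_of_eq_zero fun e =>
      KZ.restrictedEval_eq_zero_of_mem_domainAddRel _ (measurableSet_win e) hx
  · exact winSemialgebraic_of_eq_zero fun e =>
      KZ.restrictedEval_eq_zero_of_mem_integrandAddRel _ (measurableSet_win e) hx
  · obtain ⟨n, r, r', a, b, F, hF, ha, hb, hab, hdom, hcont, hderiv, hr', rfl⟩ := hx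
    cases n with
    | zero => exact nl_zero_defect r r' a b F hF ha hb hab hdom hcont hderiv
    | succ k =>
      exact winSemialgebraic_of_eq_zero fun e =>
        restrictedEval_win_nl_succ e r r' a b F hab hdom hcont hderiv hr'

end Summit.KontsevichZagierPeriods.PlanarAreas.Negative

end
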